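import Summits.KontsevichZagierPeriods.KontsevichZagierPeriods.Theorems.HurwitzMicroSectorsHurwitzSectorComplementStubAssemblyAuxDescent

/-!
# `HurwitzSectorComplement` (stmt-KontsevichZagierPeriods-14341), line `chebyshev-level-deformation`,
# stub S5 `stub_assembly` — siege k5: the DIRECT (Kubert-free) assembly, spliced across weights

Pure proof file (`--supports` the crux stmt-KontsevichZagierPeriods-14341; siege attempt k5, variation
"direct assembly + splice"). It proves the registered stub `stub_assembly` of the lead skeleton
`Cruxes/HurwitzSectorComplement/Lines/chebyshev_level_deformation.lean` (sha `35ae5381f713`) BY NAME AND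
SIGNATURE, in its own namespace `…HurwitzMicroSectorsHurwitzSectorComplement.AssemblySiegeK5`:
from the four Chebyshev-ladder descents (conclusion of S3) and the real-cyclotomic partial fractions
(S4), Conjecture 1 of Kontsevich–Zagier on the REAL-ALGEBRAIC span of the symmetric Hurwitz box
tower — two representations `[(0,1)^w, Q(t) + R(t)/(1 − t^N)]`, `t = x₁⋯x_w`, `Q, R ∈ (ℚ̄ ∩ ℝ)[t]`,
`deg R < N`, `R` `(−1)^w`-symmetric (`R_{N−1} = 0` for odd `w`), of any weights `w, w' ≥ 2` and
levels `N, N' ≥ 1`, with equal values are KZ-equivalent.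

## The direct route

The reduction of this file does NOT pass through the Kubert/distribution normal form of the
rational tower (`stub_symReduction`, level `4N`, the galois-parity-half line): every piece of the
symmetric splitting
  `Q(t) + R(t)/(1 − t^N) = Σ_k Q_k t^k + Σ_{k<N−1} (R_k/2)(t^k + (−1)^w t^{N−2−k})/(1 − t^N)
      + R_{N−1} t^{N−1}/(1 − t^N)`
is moved to the normal form `[(0,1)^w, C + A·∏ 2/(1+xᵢ²)]` (`C, A ∈ ℚ̄ ∩ ℝ`) by at most ONE
change of variables followed by a descent:

* `red_dilate` — reducedness is transported along the coordinate-power dilation `xᵢ ↦ xᵢᵐ`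
  (rule (2); the landed crux `DilationMove_of`): if `g` is reduced and
  `f(x) = g(xᵐ)·mʷ∏xᵢ^{m−1}` on the box, then `f` is reduced;
* `red_monomial` — `t^k` is the dilation image (`m = k+1`) of the rational constant `(k+1)^{−w}`;
* `red_topMonomial` — `t^{N−1}/(1 − t^N)` is the dilation image (`m = N`) of `N^{−w}/(1 − t)`, which
  is descent (C3) (`ζ(even) ∈ ℚπ^w`); it only occurs for even `w`;
* the pairs `(t^k + (−1)^w t^{N−2−k})/(1 − t^N)`, `k < N − 1`, are `Assembly.red_pair` at level
  `L = N` itself (partial fractions (P1)/(P2) + the kernel descents (C1)–(C4));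
* `red_direct` — the symmetric splitting (`Assembly.eval_symm_split`) and `ℚ̄ ∩ ℝ`-linearity of
  reducedness (`Assembly.red_add/red_smul/red_sum`).

## The splice

`nf_equivalent_of_value_eq`: the normal forms are VALUE-COMPLETE across dimensions — two normal
forms `[(0,1)^w, C + A·∏ 2/(1+xᵢ²)]`, `[(0,1)^{w'}, C' + A'·∏ 2/(1+xᵢ²)]` with real algebraic
coefficients and equal values are KZ-equivalent: the values are `C + A(π/2)^w` (`Assembly.value_nf`),
Lindemann (`Assembly.nf_coeffs_eq`) gives `C = C'` and `A = A'` (`w = w'`: one congruence move) or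
`A = A' = 0` (`w ≠ w'`: both sides are the algebraic constant `C`, spliced through the landed
rational `stub_constAcrossDim` at `c = 1` by the scaling endomorphism `KZ.Equivalent.constMul`).
`stub_assembly` is then: reduce both sides (`red_direct`), transport the equality of values to the
normal forms by soundness (`KZ.Equivalent.value_eq_holds`), and splice.

On the siege variation label "okada_stepB": Okada's rigidity (step B of `stub_okada`, the
`ℚ`-linear independence behind the rational tower) is logically idle here — the descents (S3) already
EVALUATE every kernel by moves, and no `ℚ`-linear rigidity separates `ℚ̄`-combinations of the tower
(the Galois relations, e.g. `GoldenTwistInstance`); the only rigidity the real-algebraic span needs is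
the transcendence of `π`.

References: M. Kontsevich, D. Zagier, *Periods* (2001), §1.1–1.2 (Conjecture 1, rules (1)–(3)).
No definitions are introduced.
-/

noncomputable section

open Set MeasureTheory
open scoped BigOperators
open Literature.NumberTheory.Transcendental

namespace Summit.KontsevichZagierPeriods.Theorems.HurwitzMicroSectorsHurwitzSectorComplement

namespace AssemblySiegeK5

open Assembly

variable {w : ℕ}

/-! ## Reducedness along the dilation move -/

/-- The coordinate-power map `x ↦ (xᵢᵐ)ᵢ` preserves the open unit box. [folklore] -/
theorem pow_mem_unitCube {x : Fin w → ℝ} (hx : x ∈ KZ.unitCube w) (m : ℕ) (hm : 1 ≤ m) :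
    (fun i => x i ^ m) ∈ KZ.unitCube w := fun i =>
  ⟨pow_pos (hx i).1 m, pow_lt_one₀ (hx i).1.le (hx i).2 (by omega)⟩

/-- **Transport of reducedness along ONE dilation move** (rule (2), the landed crux
`DilationMove_of`, `xᵢ ↦ xᵢᵐ`, Jacobian `mʷ ∏ xᵢ^{m−1}`): if `g` is reduced to a normal form
`[(0,1)^w, C + A·∏ 2/(1+xᵢ²)]` and `f(x) = g(xᵐ)·mʷ∏ xᵢ^{m−1}` on the open box (`f` semialgebraic and
integrable there), then `f` is reduced to the same normal form: `[(0,1)^w, f] − [(0,1)^w, g]` is a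
single change-of-variables generator. [cite: KontsevichZagier2001, §1.2 rule (2)] -/
theorem red_dilate {f g : (Fin w → ℝ) → ℝ} {m : ℕ} (hm : 1 ≤ m)
    (hg : ∃ (C A : ℝ) (s n : KZ.IntegralRep w), IsAlgebraic ℚ C ∧ IsAlgebraic ℚ A ∧
      s.domain = KZ.unitCube w ∧ n.domain = KZ.unitCube w ∧
      (∀ x ∈ KZ.unitCube w, s.integrand x = g x) ∧
      (∀ x ∈ KZ.unitCube w, n.integrand x = C + A * ∏ i, 2 / (1 + (x i) ^ 2)) ∧
      KZ.Equivalent s n)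
    (hf : IsSemialgebraicFunOn ℚ (KZ.unitCube w) f) (hfi : IntegrableOn f (KZ.unitCube w))
    (hfg : ∀ x ∈ KZ.unitCube w,
      f x = g (fun i => x i ^ m) * ((m : ℝ) ^ w * ∏ i, x i ^ (m - 1))) :
    ∃ (C A : ℝ) (s n : KZ.IntegralRep w), IsAlgebraic ℚ C ∧ IsAlgebraic ℚ A ∧
      s.domain = KZ.unitCube w ∧ n.domain = KZ.unitCube w ∧
      (∀ x ∈ KZ.unitCube w, s.integrand x = f x) ∧
      (∀ x ∈ KZ.unitCube w, n.integrand x = C + A * ∏ i, 2 / (1 + (x i) ^ 2)) ∧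
      KZ.Equivalent s n := by
  obtain ⟨C, A, s, n, hC, hA, hsd, hnd, hsi, hni, hsn⟩ := hg
  obtain ⟨r, hrd, hri⟩ := exists_boxRep hf hfi
  have hmove : KZ.of r - KZ.of s ∈ KZ.changeOfVariablesRel :=
    Summit.KontsevichZagierPeriods.HurwitzMicroSectors.DilationMove.DilationMove_of w m hm r s hrd hsd
      fun x hx => by
        rw [hrd] at hx
        rw [hri, hfg x hx, hsi _ (pow_mem_unitCube hx m hm)]
  have hrs : KZ.Equivalent r s := KZ.changeOfVariablesRel_subset_relations hmove
  exact ⟨C, A, r, n, hC, hA, hrd, hnd, fun x _ => by rw [hri], hni, hrs.trans hsn⟩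

/-- **Monomials are reduced by one dilation.** `[(0,1)^w, t^k] ≡ [(0,1)^w, (k+1)^{−w}]`
(`t = x₁⋯x_w`): the dilation `xᵢ ↦ xᵢ^{k+1}` has Jacobian `(k+1)ʷ t^k`, so the rational constant
`(k+1)^{−w}` pulls back to `t^k`. [cite: KontsevichZagier2001, §1.2 rule (2)] -/
theorem red_monomial (w k : ℕ) :
    ∃ (C A : ℝ) (s n : KZ.IntegralRep w), IsAlgebraic ℚ C ∧ IsAlgebraic ℚ A ∧
      s.domain = KZ.unitCube w ∧ n.domain = KZ.unitCube w ∧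
      (∀ x ∈ KZ.unitCube w, s.integrand x = (∏ i, x i) ^ k) ∧
      (∀ x ∈ KZ.unitCube w, n.integrand x = C + A * ∏ i, 2 / (1 + (x i) ^ 2)) ∧
      KZ.Equivalent s n := by
  have hk : ((k : ℝ) + 1) ^ w ≠ 0 := pow_ne_zero _ (by positivity)
  have hc : IsAlgebraic ℚ ((((k : ℝ) + 1) ^ w)⁻¹) := by
    have h := isAlgebraic_rat ℚ (A := ℝ) ((((k : ℚ) + 1) ^ w)⁻¹)
    push_cast at h
    exact h
  refine red_dilate (m := k + 1) (by omega) (red_const w hc)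
    ((isSemialgebraicFunOn_prod w).fun_pow k)
    (integrableOn_box_comp_prod (g := fun t => t ^ k) (by fun_prop)) fun x _ => ?_
  rw [Nat.add_sub_cancel, Finset.prod_pow]
  push_cast
  field_simp

/-- **The top monomial is reduced by one dilation and descent (C3)** (even `w ≥ 2`):
`[(0,1)^w, t^{N−1}/(1 − t^N)] ≡ [(0,1)^w, N^{−w}/(1 − t)]` by the dilation `xᵢ ↦ xᵢ^N` (Jacobian
`Nʷ t^{N−1}`), and `1/(1 − t)` lies in `ℚ·𝔭_w` by descent (C3) — in Hurwitz terms
`Σ_m 1/(Nm + N)^w = N^{−w} ζ(w)`. [cite: KontsevichZagier2001, §1.2 rules (2), (3)] -/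
theorem red_topMonomial
    (hC3 : ∀ (w : ℕ), 2 ≤ w → Even w → ∀ (r : KZ.IntegralRep w),
      r.domain = {x | ∀ i, x i ∈ Set.Ioo (0:ℝ) 1} →
      Set.EqOn r.integrand (fun x => 1 / (1 - ∏ i, x i)) r.domain →
      ∃ q : ℚ, ∀ (s : KZ.IntegralRep w), s.domain = {x | ∀ i, x i ∈ Set.Ioo (0:ℝ) 1} →
        Set.EqOn s.integrand (fun x => (q : ℝ) * ∏ i, 2 / (1 + (x i) ^ 2)) s.domain →
        KZ.Equivalent r s)
    (hw : 2 ≤ w) (he : Even w) {N : ℕ} (hN : 1 ≤ N) :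
    ∃ (C A : ℝ) (s n : KZ.IntegralRep w), IsAlgebraic ℚ C ∧ IsAlgebraic ℚ A ∧
      s.domain = KZ.unitCube w ∧ n.domain = KZ.unitCube w ∧
      (∀ x ∈ KZ.unitCube w, s.integrand x = (∏ i, x i) ^ (N - 1) / (1 - (∏ i, x i) ^ N)) ∧
      (∀ x ∈ KZ.unitCube w, n.integrand x = C + A * ∏ i, 2 / (1 + (x i) ^ 2)) ∧
      KZ.Equivalent s n := by
  have hNw : (N : ℝ) ^ w ≠ 0 := pow_ne_zero _ (by exact_mod_cast (show N ≠ 0 by omega))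
  have hc : IsAlgebraic ℚ (((N : ℝ) ^ w)⁻¹) := by
    have h := isAlgebraic_rat ℚ (A := ℝ) (((N : ℚ) ^ w)⁻¹)
    push_cast at h
    exact h
  -- descent (C3) makes `1/(1 − t)` reduced; scale it by the rational constant `N^{−w}`
  have hg : ∃ (C A : ℝ) (s n : KZ.IntegralRep w), IsAlgebraic ℚ C ∧ IsAlgebraic ℚ A ∧
      s.domain = KZ.unitCube w ∧ n.domain = KZ.unitCube w ∧
      (∀ x ∈ KZ.unitCube w, s.integrand x = ((N : ℝ) ^ w)⁻¹ * (1 / (1 - ∏ i, x i))) ∧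
      (∀ x ∈ KZ.unitCube w, n.integrand x = C + A * ∏ i, 2 / (1 + (x i) ^ 2)) ∧
      KZ.Equivalent s n := by
    obtain ⟨s, hsd, hsi⟩ := exists_invOneSubRep (w := w) hw
    exact red_smul (red_of_ratMultiple s hsd (fun x _ => by rw [hsi])
      (hC3 w hw he s hsd fun x _ => by rw [hsi])) hc
  have h1 := isSemialgebraicFunOn_const_of_isAlgebraic (KZ.isSemialgebraic_unitCube w) isAlgebraic_one
  have hp := isSemialgebraicFunOn_prod w
  refine red_dilate (m := N) hN hg
    ((hp.fun_pow (N - 1)).div (h1.fun_sub (hp.fun_pow N)) fun x hx =>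
      SymReduction.one_sub_pow_ne_zero (BoxIntegral.prod_mem_Ioo (by omega) hx) (by omega))
    (BoxIntegral.integrableOn_box_prod_pow_div_one_sub_prod_pow hw hN (N - 1)) fun x hx => ?_
  have ht := BoxIntegral.prod_mem_Ioo (n := w) (by omega) hx
  rw [Finset.prod_pow, Finset.prod_pow]
  have hD : (1 : ℝ) - (∏ i, x i) ^ N ≠ 0 := SymReduction.one_sub_pow_ne_zero ht (by omega)
  field_simp

/-! ## The direct reduction of the real-algebraic symmetric tower -/

section Direct

-- The four descents (conclusion of S3 `stub_ladderDescent`), verbatim.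
variable (hDesc : (∀ (w j L : ℕ), 2 ≤ w → Even w → 0 < j → 2 * j < L → ∀ (r : KZ.IntegralRep w),
      r.domain = {x | ∀ i, x i ∈ Set.Ioo (0:ℝ) 1} →
      Set.EqOn r.integrand (fun x =>
        ((1 - ∏ i, x i) - (Real.tan (Real.pi * j / L)) ^ 2 * (1 + ∏ i, x i)) /
          ((1 - ∏ i, x i) ^ 2 + (Real.tan (Real.pi * j / L)) ^ 2 * (1 + ∏ i, x i) ^ 2)) r.domain →
      ∃ q : ℚ, ∀ (s : KZ.IntegralRep w), s.domain = {x | ∀ i, x i ∈ Set.Ioo (0:ℝ) 1} →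
        Set.EqOn s.integrand (fun x => (q : ℝ) * ∏ i, 2 / (1 + (x i) ^ 2)) s.domain →
        KZ.Equivalent r s) ∧
    (∀ (w j L : ℕ), 3 ≤ w → Odd w → 0 < j → 2 * j < L → ∀ (r : KZ.IntegralRep w),
      r.domain = {x | ∀ i, x i ∈ Set.Ioo (0:ℝ) 1} →
      Set.EqOn r.integrand (fun x =>
        2 * Real.tan (Real.pi * j / L) /
          ((1 - ∏ i, x i) ^ 2 + (Real.tan (Real.pi * j / L)) ^ 2 * (1 + ∏ i, x i) ^ 2)) r.domain →
      ∃ q : ℚ, ∀ (s : KZ.IntegralRep w), s.domain = {x | ∀ i, x i ∈ Set.Ioo (0:ℝ) 1} →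
        Set.EqOn s.integrand (fun x => (q : ℝ) * ∏ i, 2 / (1 + (x i) ^ 2)) s.domain →
        KZ.Equivalent r s) ∧
    (∀ (w : ℕ), 2 ≤ w → Even w → ∀ (r : KZ.IntegralRep w),
      r.domain = {x | ∀ i, x i ∈ Set.Ioo (0:ℝ) 1} →
      Set.EqOn r.integrand (fun x => 1 / (1 - ∏ i, x i)) r.domain →
      ∃ q : ℚ, ∀ (s : KZ.IntegralRep w), s.domain = {x | ∀ i, x i ∈ Set.Ioo (0:ℝ) 1} →
        Set.EqOn s.integrand (fun x => (q : ℝ) * ∏ i, 2 / (1 + (x i) ^ 2)) s.domain →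
        KZ.Equivalent r s) ∧
    (∀ (w : ℕ), 2 ≤ w → Even w → ∀ (r : KZ.IntegralRep w),
      r.domain = {x | ∀ i, x i ∈ Set.Ioo (0:ℝ) 1} →
      Set.EqOn r.integrand (fun x => 1 / (1 + ∏ i, x i)) r.domain →
      ∃ q : ℚ, ∀ (s : KZ.IntegralRep w), s.domain = {x | ∀ i, x i ∈ Set.Ioo (0:ℝ) 1} →
        Set.EqOn s.integrand (fun x => (q : ℝ) * ∏ i, 2 / (1 + (x i) ^ 2)) s.domain →
        KZ.Equivalent r s))

-- The partial fractions and half-angle identities (S4 `stub_partialFractions`), verbatim.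
variable (hPF : (∀ (L a : ℕ), 0 < a → a < L → ∀ (t : ℝ), 0 ≤ t → t < 1 →
      (t ^ (a - 1) + t ^ (L - 1 - a)) / (1 - t ^ L) =
        2 / (L : ℝ) * ∑ j ∈ Finset.range L, Real.cos (2 * Real.pi * j * a / L) *
          ((Real.cos (2 * Real.pi * j / L) - t) / (1 - 2 * Real.cos (2 * Real.pi * j / L) * t + t ^ 2))) ∧
    (∀ (L a : ℕ), 0 < a → a < L → ∀ (t : ℝ), 0 ≤ t → t < 1 →
      (t ^ (a - 1) - t ^ (L - 1 - a)) / (1 - t ^ L) =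
        2 / (L : ℝ) * ∑ j ∈ Finset.range L, Real.sin (2 * Real.pi * j * a / L) *
          (Real.sin (2 * Real.pi * j / L) / (1 - 2 * Real.cos (2 * Real.pi * j / L) * t + t ^ 2))) ∧
    (∀ (u t : ℝ), 0 < u → u < Real.pi →
      (Real.cos u - t) / (1 - 2 * Real.cos u * t + t ^ 2) =
        ((1 - t) - (Real.tan (u / 2)) ^ 2 * (1 + t)) / ((1 - t) ^ 2 + (Real.tan (u / 2)) ^ 2 * (1 + t) ^ 2) ∧
      Real.sin u / (1 - 2 * Real.cos u * t + t ^ 2) =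
        2 * Real.tan (u / 2) / ((1 - t) ^ 2 + (Real.tan (u / 2)) ^ 2 * (1 + t) ^ 2)))

include hDesc hPF

/-- **The symmetric pair pieces are reduced at their own level.** For `k < N − 1` the pair
`(t^k + (−1)^w t^{N−2−k})/(1 − t^N)` is the symmetric pair `a = k + 1` of level `L = N`
(`Assembly.red_pair`: partial fractions (P1)/(P2) and the kernel descents). [cite: KontsevichZagier2001, §1.2] -/
theorem red_pairPiece (hw : 2 ≤ w) {N k : ℕ} (hk : k < N - 1) :
    ∃ (C A : ℝ) (s n : KZ.IntegralRep w), IsAlgebraic ℚ C ∧ IsAlgebraic ℚ A ∧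
      s.domain = KZ.unitCube w ∧ n.domain = KZ.unitCube w ∧
      (∀ x ∈ KZ.unitCube w, s.integrand x =
        ((∏ i, x i) ^ k + (-1 : ℝ) ^ w * (∏ i, x i) ^ (N - 2 - k)) / (1 - (∏ i, x i) ^ N)) ∧
      (∀ x ∈ KZ.unitCube w, n.integrand x = C + A * ∏ i, 2 / (1 + (x i) ^ 2)) ∧
      KZ.Equivalent s n := by
  refine red_congr (red_pair hDesc hPF hw (L := N) (a := k + 1) (Nat.succ_pos k) (by omega))
    fun x _ => ?_
  rw [Nat.add_sub_cancel, show N - 1 - (k + 1) = N - 2 - k by omega]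

/-- **(Red), directly.** `Q(t) + R(t)/(1 − t^N)` with `Q, R ∈ (ℚ̄ ∩ ℝ)[t]`, `deg R < N`, `R`
`(−1)^w`-symmetric (`R_{N−1} = 0` for odd `w`) is reduced to a normal form
`[(0,1)^w, C + A·∏ 2/(1+xᵢ²)]`, `C, A ∈ ℚ̄ ∩ ℝ`: split symmetrically
(`Assembly.eval_symm_split`); the monomials `Q_k t^k` are dilation images of constants
(`red_monomial`), the pairs are `red_pairPiece`, the top monomial `R_{N−1} t^{N−1}/(1 − t^N)` is
absent for odd `w` and a dilation image of `N^{−w}/(1 − t)` for even `w` (`red_topMonomial`); combine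
by `ℚ̄ ∩ ℝ`-linearity of reducedness. No Kubert/distribution normal form is used.
[cite: KontsevichZagier2001, §1.2] -/
theorem red_direct {N : ℕ} (hw : 2 ≤ w) (hN : 1 ≤ N) (Q R : Polynomial ℝ)
    (hQ : ∀ i, IsAlgebraic ℚ (Q.coeff i)) (hRa : ∀ i, IsAlgebraic ℚ (R.coeff i))
    (hR : R.natDegree < N)
    (hsym : ∀ i j : ℕ, i + j + 2 = N → R.coeff i = (-1 : ℝ) ^ w * R.coeff j)
    (hodd : Odd w → R.coeff (N - 1) = 0) :
    ∃ (C A : ℝ) (s n : KZ.IntegralRep w), IsAlgebraic ℚ C ∧ IsAlgebraic ℚ A ∧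
      s.domain = KZ.unitCube w ∧ n.domain = KZ.unitCube w ∧
      (∀ x ∈ KZ.unitCube w, s.integrand x =
        Polynomial.eval (∏ i, x i) Q + Polynomial.eval (∏ i, x i) R / (1 - (∏ i, x i) ^ N)) ∧
      (∀ x ∈ KZ.unitCube w, n.integrand x = C + A * ∏ i, 2 / (1 + (x i) ^ 2)) ∧
      KZ.Equivalent s n := by
  have h2 : IsAlgebraic ℚ (2 : ℝ) := by simpa using isAlgebraic_nat (R := ℚ) (A := ℝ) 2
  -- the polynomial part: one dilation per monomial
  have hQred : ∃ (C A : ℝ) (s n : KZ.IntegralRep w), IsAlgebraic ℚ C ∧ IsAlgebraic ℚ A ∧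
      s.domain = KZ.unitCube w ∧ n.domain = KZ.unitCube w ∧
      (∀ x ∈ KZ.unitCube w, s.integrand x =
        ∑ k ∈ Finset.range (Q.natDegree + 1), Q.coeff k * (∏ i, x i) ^ k) ∧
      (∀ x ∈ KZ.unitCube w, n.integrand x = C + A * ∏ i, 2 / (1 + (x i) ^ 2)) ∧
      KZ.Equivalent s n :=
    red_sum _ fun k _ => red_smul (red_monomial w k) (hQ k)
  -- the symmetric pairs, each at level `N`
  have hPred : ∃ (C A : ℝ) (s n : KZ.IntegralRep w), IsAlgebraic ℚ C ∧ IsAlgebraic ℚ A ∧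
      s.domain = KZ.unitCube w ∧ n.domain = KZ.unitCube w ∧
      (∀ x ∈ KZ.unitCube w, s.integrand x = ∑ k ∈ Finset.range (N - 1),
        R.coeff k / 2 * (((∏ i, x i) ^ k + (-1 : ℝ) ^ w * (∏ i, x i) ^ (N - 2 - k)) /
          (1 - (∏ i, x i) ^ N))) ∧
      (∀ x ∈ KZ.unitCube w, n.integrand x = C + A * ∏ i, 2 / (1 + (x i) ^ 2)) ∧
      KZ.Equivalent s n :=
    red_sum _ fun k hk => red_congr (red_smul (red_pairPiece hDesc hPF hw (Finset.mem_range.mp hk))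
      ((hRa k).mul h2.inv)) fun x _ => by rw [div_eq_mul_inv (R.coeff k)]
  -- the top monomial: absent for odd `w`, one dilation + descent (C3) for even `w`
  have hTred : ∃ (C A : ℝ) (s n : KZ.IntegralRep w), IsAlgebraic ℚ C ∧ IsAlgebraic ℚ A ∧
      s.domain = KZ.unitCube w ∧ n.domain = KZ.unitCube w ∧
      (∀ x ∈ KZ.unitCube w, s.integrand x =
        R.coeff (N - 1) * ((∏ i, x i) ^ (N - 1) / (1 - (∏ i, x i) ^ N))) ∧
      (∀ x ∈ KZ.unitCube w, n.integrand x = C + A * ∏ i, 2 / (1 + (x i) ^ 2)) ∧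
      KZ.Equivalent s n := by
    rcases Nat.even_or_odd w with he | ho
    · exact red_smul (red_topMonomial hDesc.2.2.1 hw he hN) (hRa (N - 1))
    · exact red_congr (red_const w isAlgebraic_zero) fun x _ => by rw [hodd ho, zero_mul]
  -- reassemble the symmetric splitting
  refine red_congr (red_add hQred (red_add hPred hTred)) fun x _ => ?_
  rw [Polynomial.eval_eq_sum_range, eval_symm_split R hN hR hsym, add_div, Finset.sum_div]
  refine congrArg₂ (· + ·) rfl (congrArg₂ (· + ·) (Finset.sum_congr rfl fun k _ => ?_) ?_)
  · ring
  · ring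

end Direct

/-! ## The splice: normal forms are value-complete across dimensions -/

/-- **Normal forms with equal values are KZ-equivalent, across dimensions.** For real algebraic
`C, A, C', A'` and `w, w' ≥ 1`: if `[(0,1)^w, C + A·∏ 2/(1+xᵢ²)]` and
`[(0,1)^{w'}, C' + A'·∏ 2/(1+xᵢ²)]` have the same value then they are KZ-equivalent. The values are
`C + A(π/2)^w`, `C' + A'(π/2)^{w'}`; by the transcendence of `π` (Lindemann) `C = C'` and either
`w = w'`, `A = A'` (one congruence move) or `w ≠ w'`, `A = A' = 0`, where both sides are the
algebraic constant `C = C ⊙ [(0,1)^•, 1]` and the rational constants across dimensions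
(`stub_constAcrossDim`, slabs and null faces) are pushed through the scaling endomorphism.
[cite: KontsevichZagier2001, §1.2 Conjecture 1] -/
theorem nf_equivalent_of_value_eq {w w' : ℕ} (hw : 1 ≤ w) (hw' : 1 ≤ w') {C A C' A' : ℝ}
    (hC : IsAlgebraic ℚ C) (hA : IsAlgebraic ℚ A) (hC' : IsAlgebraic ℚ C') (hA' : IsAlgebraic ℚ A')
    (n : KZ.IntegralRep w) (n' : KZ.IntegralRep w')
    (hnd : n.domain = KZ.unitCube w) (hn'd : n'.domain = KZ.unitCube w')
    (hni : ∀ x ∈ KZ.unitCube w, n.integrand x = C + A * ∏ i, 2 / (1 + (x i) ^ 2))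
    (hn'i : ∀ x ∈ KZ.unitCube w', n'.integrand x = C' + A' * ∏ i, 2 / (1 + (x i) ^ 2))
    (hv : n.value = n'.value) : KZ.Equivalent n n' := by
  have hval : C + A * (Real.pi / 2) ^ w = C' + A' * (Real.pi / 2) ^ w' := by
    rw [← value_nf n hnd hni, ← value_nf n' hn'd hn'i, hv]
  obtain ⟨hCC, hsame, hdiff⟩ := nf_coeffs_eq hC hA hC' hA' (by omega) (by omega) hval
  subst hCC
  by_cases hww : w = w'
  · -- equal weights: the two normal forms have the same integrand on the same box
    subst hww
    obtain rfl := hsame rfl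
    exact KZ.of_sub_of_mem_relations_of_eqOn (hn'd.trans hnd.symm) fun x hx => by
      rw [hnd] at hx
      rw [hni x hx, hn'i x hx]
  · -- different weights: both normal forms are the constant `C`; splice through `[(0,1)^•, 1]`
    obtain ⟨rfl, rfl⟩ := hdiff hww
    obtain ⟨K, hKd, hKi⟩ := ConstAcrossDim.exists_constRep w 1
    obtain ⟨K', hK'd, hK'i⟩ := ConstAcrossDim.exists_constRep w' 1
    have hKK' : KZ.Equivalent (K.constMul C hC) (K'.constMul C hC) :=
      KZ.Equivalent.constMul C hC (stub_constAcrossDim w w' 1 K K' hw hw' hKd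
        (fun x _ => congrFun hKi x) hK'd fun x _ => congrFun hK'i x)
    have hnK : KZ.Equivalent n (K.constMul C hC) :=
      KZ.of_sub_of_mem_relations_of_eqOn (hKd.trans hnd.symm) fun x hx => by
        rw [hnd] at hx
        rw [hni x hx, KZ.IntegralRep.integrand_constMul, hKi]
        push_cast
        ring
    have hK'n' : KZ.Equivalent (K'.constMul C hC) n' :=
      KZ.of_sub_of_mem_relations_of_eqOn (hn'd.trans hK'd.symm) fun x hx => by
        rw [KZ.IntegralRep.domain_constMul, hK'd] at hx
        rw [KZ.IntegralRep.integrand_constMul, hK'i, hn'i x hx]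
        push_cast
        ring
    exact (hnK.trans hKK').trans hK'n'

end AssemblySiegeK5

namespace AssemblySiegeK5

/-- **S5, assembly** (registered stub `stub_assembly` of the lead skeleton, VERBATIM signature; siege k5,
the direct route). From the four descents (S3) and the partial fractions (S4): Conjecture 1 on the
REAL-ALGEBRAIC span of the symmetric Hurwitz tower, across all weights `w, w' ≥ 2` and levels
`N, N' ≥ 1`. Both representations are congruent on the box to representations reduced DIRECTLY
(`red_direct`: dilations for the monomials and the top monomial, partial fractions at level `N` for
the pairs — no Kubert normal form) to normal forms `[(0,1)^•, C + A·∏ 2/(1+xᵢ²)]` with real algebraic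
coefficients; soundness transports the equality of values to the normal forms, which are
value-complete across dimensions (`nf_equivalent_of_value_eq`: Lindemann + the constant splice).
[cite: KontsevichZagier2001, §1.2 Conjecture 1] -/
theorem stub_assembly : ((∀ (w j L : ℕ), 2 ≤ w → Even w → 0 < j → 2 * j < L → ∀ (r : KZ.IntegralRep w), r.domain = {x | ∀ i, x i ∈ Set.Ioo (0:ℝ) 1} → Set.EqOn r.integrand (fun x => ((1 - ∏ i, x i) - (Real.tan (Real.pi * j / L)) ^ 2 * (1 + ∏ i, x i)) / ((1 - ∏ i, x i) ^ 2 + (Real.tan (Real.pi * j / L)) ^ 2 * (1 + ∏ i, x i) ^ 2)) r.domain → ∃ q : ℚ, ∀ (s : KZ.IntegralRep w), s.domain = {x | ∀ i, x i ∈ Set.Ioo (0:ℝ) 1} → Set.EqOn s.integrand (fun x => (q : ℝ) * ∏ i, 2 / (1 + (x i) ^ 2)) s.domain → KZ.Equivalent r s) ∧ (∀ (w j L : ℕ), 3 ≤ w → Odd w → 0 < j → 2 * j < L → ∀ (r : KZ.IntegralRep w), r.domain = {x | ∀ i, x i ∈ Set.Ioo (0:ℝ) 1} → Set.EqOn r.integrand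 (fun x => 2 * Real.tan (Real.pi * j / L) / ((1 - ∏ i, x i) ^ 2 + (Real.tan (Real.pi * j / L)) ^ 2 * (1 + ∏ i, x i) ^ 2)) r.domain → ∃ q : ℚ, ∀ (s : KZ.IntegralRep w), s.domain = {x | ∀ i, x i ∈ Set.Ioo (0:ℝ) 1} → Set.EqOn s.integrand (fun x => (q : ℝ) * ∏ i, 2 / (1 + (x i) ^ 2)) s.domain → KZ.Equivalent r s) ∧ (∀ (w : ℕ), 2 ≤ w → Even w → ∀ (r : KZ.IntegralRep w), r.domain = {x | ∀ i, x i ∈ Set.Ioo (0:ℝ) 1} → Set.EqOn r.integrand (fun x => 1 / (1 - ∏ i, x i)) r.domain → ∃ q : ℚ, ∀ (s : KZ.IntegralRep w), s.domain = {x | ∀ i, x i ∈ Set.Ioo (0:ℝ) 1} → Set.EqOn s.integrand (fun x => (q : ℝ) * ∏ i, 2 / (1 + (x i) ^ 2)) s.domain → KZ.Equivalent r s) ∧ (∀ (w : ℕ), 2 ≤ w → Even w → ∀ (r : KZ.IntegralRep w), r.domain = {x | ∀ i, x i ∈ Set.Ioo (0:ℝ) 1} → Set.EqOn r.integrand (fun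 x => 1 / (1 + ∏ i, x i)) r.domain → ∃ q : ℚ, ∀ (s : KZ.IntegralRep w), s.domain = {x | ∀ i, x i ∈ Set.Ioo (0:ℝ) 1} → Set.EqOn s.integrand (fun x => (q : ℝ) * ∏ i, 2 / (1 + (x i) ^ 2)) s.domain → KZ.Equivalent r s)) → ((∀ (L a : ℕ), 0 < a → a < L → ∀ (t : ℝ), 0 ≤ t → t < 1 → (t ^ (a - 1) + t ^ (L - 1 - a)) / (1 - t ^ L) = 2 / (L : ℝ) * ∑ j ∈ Finset.range L, Real.cos (2 * Real.pi * j * a / L) * ((Real.cos (2 * Real.pi * j / L) - t) / (1 - 2 * Real.cos (2 * Real.pi * j / L) * t + t ^ 2))) ∧ (∀ (L a : ℕ), 0 < a → a < L → ∀ (t : ℝ), 0 ≤ t → t < 1 → (t ^ (a - 1) - t ^ (L - 1 - a)) / (1 - t ^ L) = 2 / (L : ℝ) * ∑ j ∈ Finset.range L, Real.sin (2 * Real.pi * j * a / L) * (Real.sin (2 * Real.pi * j / L) / (1 - 2 * Real.cos (2 * Real.pi * j / L) * t + t ^ 2))) ∧ (∀ (u t : ℝ), 0 < u → u < Real.pi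 → (Real.cos u - t) / (1 - 2 * Real.cos u * t + t ^ 2) = ((1 - t) - (Real.tan (u / 2)) ^ 2 * (1 + t)) / ((1 - t) ^ 2 + (Real.tan (u / 2)) ^ 2 * (1 + t) ^ 2) ∧ Real.sin u / (1 - 2 * Real.cos u * t + t ^ 2) = 2 * Real.tan (u / 2) / ((1 - t) ^ 2 + (Real.tan (u / 2)) ^ 2 * (1 + t) ^ 2))) → ∀ (w N w' N' : ℕ), 2 ≤ w → 1 ≤ N → 2 ≤ w' → 1 ≤ N' → ∀ (r : KZ.IntegralRep w) (r' : KZ.IntegralRep w'), (∃ (Q R : Polynomial ℝ), (∀ i, IsAlgebraic ℚ (Q.coeff i)) ∧ (∀ i, IsAlgebraic ℚ (R.coeff i)) ∧ R.natDegree < N ∧ (∀ i j : ℕ, i + j + 2 = N → R.coeff i = (-1 : ℝ) ^ w * R.coeff j) ∧ (Odd w → R.coeff (N - 1) = 0) ∧ r.domain = {x | ∀ i, x i ∈ Set.Ioo (0:ℝ) 1} ∧ Set.EqOn r.integrand (fun x => Polynomial.eval (∏ i, x i) Q + Polynomial.eval (∏ i, x i) R / (1 - (∏ i, x i) ^ N))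 r.domain) → (∃ (Q R : Polynomial ℝ), (∀ i, IsAlgebraic ℚ (Q.coeff i)) ∧ (∀ i, IsAlgebraic ℚ (R.coeff i)) ∧ R.natDegree < N' ∧ (∀ i j : ℕ, i + j + 2 = N' → R.coeff i = (-1 : ℝ) ^ w' * R.coeff j) ∧ (Odd w' → R.coeff (N' - 1) = 0) ∧ r'.domain = {x | ∀ i, x i ∈ Set.Ioo (0:ℝ) 1} ∧ Set.EqOn r'.integrand (fun x => Polynomial.eval (∏ i, x i) Q + Polynomial.eval (∏ i, x i) R / (1 - (∏ i, x i) ^ N')) r'.domain) → r.value = r'.value → KZ.Equivalent r r' := by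
  intro hDesc hPF w N w' N' hw hN hw' hN' r r' ⟨Q, R, hQ, hRa, hR, hsym, hodd, hd, hf⟩
    ⟨Q', R', hQ', hRa', hR', hsym', hodd', hd', hf'⟩ hv
  -- (Red), directly, on both sides
  obtain ⟨C, A, s, n, hC, hA, hsd, hnd, hsi, hni, hsn⟩ :=
    red_direct hDesc hPF hw hN Q R hQ hRa hR hsym hodd
  obtain ⟨C', A', s', n', hC', hA', hs'd, hn'd, hs'i, hn'i, hs'n'⟩ :=
    red_direct hDesc hPF hw' hN' Q' R' hQ' hRa' hR' hsym' hodd'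
  -- the given representations are congruent to the reduced ones, hence equivalent to the normal forms
  have hrs : KZ.Equivalent r s :=
    KZ.of_sub_of_mem_relations_of_eqOn (hsd.trans hd.symm) fun x hx => by
      rw [hf hx, hsi x (by rw [hd] at hx; exact hx)]
  have hr's' : KZ.Equivalent r' s' :=
    KZ.of_sub_of_mem_relations_of_eqOn (hs'd.trans hd'.symm) fun x hx => by
      rw [hf' hx, hs'i x (by rw [hd'] at hx; exact hx)]
  have hrn : KZ.Equivalent r n := hrs.trans hsn
  have hr'n' : KZ.Equivalent r' n' := hr's'.trans hs'n'
  -- soundness: the normal forms have the same value; splice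
  have hnn' : n.value = n'.value := by
    rw [← KZ.Equivalent.value_eq_holds hrn, ← KZ.Equivalent.value_eq_holds hr'n', hv]
  exact (hrn.trans (nf_equivalent_of_value_eq (by omega) (by omega) hC hA hC' hA' n n' hnd hn'd
    hni hn'i hnn')).trans hr'n'.symm

end AssemblySiegeK5

end Summit.KontsevichZagierPeriods.Theorems.HurwitzMicroSectorsHurwitzSectorComplement

end
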